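import Summits.BirchSwinnertonDyer.BirchSwinnertonDyer.Theorems.ShadowIsolationShaCotorsionReducibleOfThesis
import Summits.BirchSwinnertonDyer.BirchSwinnertonDyer.Theorems.ShadowIsolationCruxesToTarget
import Summits.BirchSwinnertonDyer.BirchSwinnertonDyer.Theorems.ShadowIsolationShaUnboundedOfCorank
import Summits.BirchSwinnertonDyer.BirchSwinnertonDyer.Theorems.ShadowIsolationPrimeSupplyIrreducible
import Summits.BirchSwinnertonDyer.BirchSwinnertonDyer.Theorems.ShadowIsolationAssembly

/-!
# BirchSwinnertonDyer / ShadowIsolation — the route closes WITHOUT its Eisenstein crux `R`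
# (crux `ShaCotorsionReducible`, stmt-BirchSwinnertonDyer-15277, is redundant: fully discharged form)

Lead c3 of crux stmt-15277. With the route's support/assembly layer now PROVED in the tree —
`shaUnboundedOfCorank_proof` (stmt-15490), `primeSupplyIrreducible_proof` (stmt-15491),
`cruxesToTarget_proof` (stmt-15492), `shadowIsolation_assembly_proof` (stmt-15493) — the two structural
facts about the residual Eisenstein crux `R = ShaCotorsionReducible` take their final, hypothesis-minimal form:

* `shaCotorsionReducible_of_cruxes` — `IsolationOfAccidentalZeros → PhantomShadow → SelmerRankUB →
  SelmerRankLB → SelmerRankSmallImage → ShaCotorsionReducible`: the five OTHER crux hypotheses of the route's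
  deciding theorem `closes` already imply `R` (glue ⇒ target `X`; `X` at an auxiliary irreducible prime +
  `SmallImage` at the Eisenstein prime + Greenberg's identity twice, `shaCotorsionReducible_of_route_items`);
* `birchSwinnertonDyer_of_cruxes_without_shaCotorsionReducible` — `IsolationOfAccidentalZeros → PhantomShadow →
  SelmerRankUB → SelmerRankLB → SelmerRankSmallImage → BirchSwinnertonDyer`: the deciding theorem's conclusion
  from its hypotheses MINUS `hRed` (glue ⇒ `X`; assembly with the proved prime supply).

Hence item stmt-15277 carries no weight in route `ShadowIsolation`; the planner's `route edit --closes-file`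
(`Cruxes/ShaCotorsionReducible/ClosesWithSupply.lean`, same import cone) merely records this in the route file.
As a stand-alone statement `R` is `Ш[p^∞]`-cotorsion at an Eisenstein prime = crux stmt-0132 restricted to the
sector, open from `min(corank Sel_{p^∞}, r_an) ≥ 2` (files `…Reductions`, `…Residue`).
-/

-- D-0017: single-problem summit, so `Summit.BirchSwinnertonDyer.BirchSwinnertonDyer.…` repeats a
-- namespace BY DESIGN.
set_option linter.dupNamespace false

namespace Summit.BirchSwinnertonDyer.BirchSwinnertonDyer.Theorems

open Summit.BirchSwinnertonDyer.BirchSwinnertonDyer.Theses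

/-- **`R` from the route's five other cruxes (fully discharged).** `IsolationOfAccidentalZeros →
PhantomShadow → SelmerRankUB → SelmerRankLB → SelmerRankSmallImage → ShaCotorsionReducible`, by
`shaCotorsionReducible_of_route_items` fed with the proved support items `cruxesToTarget_proof`,
`shaUnboundedOfCorank_proof`, `primeSupplyIrreducible_proof`. [cite: Greenberg1999LNM, §1 pp. 54–57] -/
theorem shaCotorsionReducible_of_cruxes : Summit.BirchSwinnertonDyer.BirchSwinnertonDyer.Theses.ShadowIsolation.IsolationOfAccidentalZeros → Summit.BirchSwinnertonDyer.BirchSwinnertonDyer.Theses.ShadowIsolation.PhantomShadow → Summit.BirchSwinnertonDyer.BirchSwinnertonDyer.Theses.ShadowIsolation.SelmerRankUB → Summit.BirchSwinnertonDyer.BirchSwinnertonDyer.Theses.ShadowIsolation.SelmerRankLB → Summit.BirchSwinnertonDyer.BirchSwinnertonDyer.Theses.ShadowIsolation.SelmerRankSmallImage → Summit.BirchSwinnertonDyer.BirchSwinnertonDyer.Theses.ShadowIsolation.ShaCotorsionReducible :=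
  fun hIso hSh hUB hLB hSI =>
    shaCotorsionReducible_of_route_items cruxesToTarget_proof shaUnboundedOfCorank_proof
      primeSupplyIrreducible_proof hIso hSh hUB hLB hSI

/-- **The route's conclusion WITHOUT `R` (fully discharged).** `IsolationOfAccidentalZeros → PhantomShadow →
SelmerRankUB → SelmerRankLB → SelmerRankSmallImage → BirchSwinnertonDyer`: the glue `cruxesToTarget_proof`
(with `shaUnboundedOfCorank_proof`) gives the target `X`, and the assembly `shadowIsolation_assembly_proof`
with the proved supply `primeSupplyIrreducible_proof` gives the Statement — the hypothesis
`hRed : ShaCotorsionReducible` of the route's `closes` is never needed.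
[cite: Greenberg1999LNM, §1 pp. 54–57] [cite: SilvermanAEC2009, Cor. IX.6.3] -/
theorem birchSwinnertonDyer_of_cruxes_without_shaCotorsionReducible
    (hIso : ShadowIsolation.IsolationOfAccidentalZeros) (hSh : ShadowIsolation.PhantomShadow)
    (hUB : ShadowIsolation.SelmerRankUB) (hLB : ShadowIsolation.SelmerRankLB)
    (hSI : ShadowIsolation.SelmerRankSmallImage) : _root_.BirchSwinnertonDyer :=
  shadowIsolation_assembly_proof
    (cruxesToTarget_proof hIso hSh shaUnboundedOfCorank_proof hUB hLB hSI) primeSupplyIrreducible_proof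

end Summit.BirchSwinnertonDyer.BirchSwinnertonDyer.Theorems
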